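import Mathlib.NumberTheory.Chebyshev
import Mathlib.Analysis.Complex.ExponentialBounds
import HarnessLib

/-!
# `ψ(x) ≤ 1.04 x` for `x ≤ 10⁴` by a kernel computation of `lcm(1, …, n)`

Topic: `Literature/NumberTheory/LFunctions`. THEOREMS (everything proved; one `decide +kernel`).
Auxiliary input to the discharge of `Literature.NumberTheory.LFunctions.schoenfeld_explicit` (Schoenfeld 1976,
Cor. 1): the passage from `ψ` to `θ` and `π` uses `ψ(x) − θ(x) ≤ ψ(√x) + ψ(x^{1/3}) + ψ(x^{1/5})`
(Mathlib's `Chebyshev.psi_sub_theta_le_psi_add_psi_add_psi`) together with a bound `ψ(y) ≤ 1.04 y`.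
Rosser–Schoenfeld 1962, Theorem 12, give `ψ(x) < 1.03883 x` for all `x > 0` (maximum at `x = 113`);
under RH the range `y ≥ 10⁴` follows from the differenced explicit formula
(`SchoenfeldPsiExplicit.lean`), and the range `y ≤ 10⁴` is settled here by exact integer arithmetic:
with `L_n = lcm(1, …, n) = e^{ψ(n)}` (Mathlib's `Nat.lcmUpto`, `Chebyshev.psi_eq_log_lcmUpto`) the kernel
checks `L_n⁸ < 2^{k_n}`, `k_n = ⌊83200000 n / 6931472⌋` (so `k_n log 2 ≤ 8.32 n`, `log 2 < 0.6931472`),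
for every `1 ≤ n ≤ 10⁴` (`psiCheck_holds`), whence `ψ(n) < 1.04 n` and `ψ(x) ≤ 1.04 x` for real
`0 ≤ x ≤ 10⁴` (`psi_le_of_le_ten_thousand`).

## References

* J. B. Rosser, L. Schoenfeld, *Approximate formulas for some functions of prime numbers*, Illinois
  J. Math. 6 (1962), 64–94, Theorem 12 (`ψ(x) < 1.03883 x`). [RosserSchoenfeld1962]
-/

open Real
open scoped Chebyshev

namespace Literature.NumberTheory.LFunctions

namespace SchoenfeldBound

/-- The exponent budget `k_n = ⌊83200000 n / 6931472⌋` (`k_n log 2 ≤ 8.32 n`). [folklore] -/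
def kOf (n : ℕ) : ℕ := 83200000 * n / 6931472

/-- The check for `n+1, …, n+fuel` with the running least common multiple `L = lcm(1, …, n)`:
`L_m⁸ < 2^{k_m}` for each `m`. [folklore] -/
def psiCheck : ℕ → ℕ → ℕ → Bool
  | _, _, 0 => true
  | n, L, fuel + 1 => (Nat.lcm (n + 1) L) ^ 8 < 2 ^ kOf (n + 1) && psiCheck (n + 1) (Nat.lcm (n + 1) L) fuel

/-- `lcmUpto (n+1) = lcm (n+1) (lcmUpto n)`. [folklore] -/
theorem lcmUpto_succ (n : ℕ) : Nat.lcmUpto (n + 1) = Nat.lcm (n + 1) (Nat.lcmUpto n) := by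
  unfold Nat.lcmUpto
  rw [← Finset.insert_Icc_right_eq_Icc_add_one (Nat.le_add_left 1 n), Finset.lcm_insert]
  rfl

/-- Soundness of `psiCheck`: from `L = lcmUpto n`, a passing check gives `(lcmUpto m)⁸ < 2^{k_m}` for
`n < m ≤ n + fuel`. [folklore] -/
theorem psiCheck_sound : ∀ (fuel n L : ℕ), psiCheck n L fuel = true → L = Nat.lcmUpto n →
    ∀ m, n < m → m ≤ n + fuel → Nat.lcmUpto m ^ 8 < 2 ^ kOf m := by
  intro fuel
  induction fuel with
  | zero => intro n L _ _ m h1 h2; omega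
  | succ fuel ih =>
    intro n L h hL m h1 h2
    simp only [psiCheck, Bool.and_eq_true, decide_eq_true_eq] at h
    obtain ⟨hstep, hrest⟩ := h
    have hL' : Nat.lcm (n + 1) L = Nat.lcmUpto (n + 1) := by rw [hL, lcmUpto_succ]
    rcases Nat.lt_or_ge (n + 1) m with hlt | hge
    · exact ih (n + 1) _ hrest hL' m hlt (by omega)
    · have hm : m = n + 1 := by omega
      subst hm
      rwa [hL'] at hstep

/-- **The kernel computation**: `psiCheck 0 1 10000 = true` (`lcmUpto 0 = 1`). [cite: RosserSchoenfeld1962, Theorem 12] -/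
theorem psiCheck_holds : psiCheck 0 1 10000 = true := by
  decide +kernel

/-- `(lcmUpto n)⁸ < 2^{k_n}` for `1 ≤ n ≤ 10⁴`. [cite: RosserSchoenfeld1962, Theorem 12] -/
theorem lcmUpto_pow_lt {n : ℕ} (h1 : 1 ≤ n) (h2 : n ≤ 10000) : Nat.lcmUpto n ^ 8 < 2 ^ kOf n :=
  psiCheck_sound 10000 0 1 psiCheck_holds (by simp [Nat.lcmUpto]) n h1 (by omega)

/-- `ψ(n) < 1.04 n` for `1 ≤ n ≤ 10⁴`. [cite: RosserSchoenfeld1962, Theorem 12] -/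
theorem psi_nat_lt {n : ℕ} (h1 : 1 ≤ n) (h2 : n ≤ 10000) : ψ (n : ℝ) < 1.04 * n := by
  have h := lcmUpto_pow_lt h1 h2
  have hL0 : (0 : ℝ) < Nat.lcmUpto n := by exact_mod_cast Nat.pos_of_ne_zero (Nat.lcmUpto_ne_zero n)
  have hlog : 8 * Real.log (Nat.lcmUpto n) < kOf n * Real.log 2 := by
    have h' : ((Nat.lcmUpto n : ℝ)) ^ 8 < (2 : ℝ) ^ kOf n := by exact_mod_cast h
    have := Real.log_lt_log (by positivity) h'
    rwa [Real.log_pow, Real.log_pow] at this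
  have hk : (kOf n : ℝ) ≤ 83200000 * n / 6931472 := by
    have := Nat.cast_div_le (m := 83200000 * n) (n := 6931472) (α := ℝ)
    simpa [kOf] using this
  have hl2 := Real.log_two_lt_d9
  have hl2' := Real.log_two_gt_d9
  have hn : (1 : ℝ) ≤ n := by exact_mod_cast h1
  rw [Chebyshev.psi_eq_log_lcmUpto]
  have h2nn : (0 : ℝ) ≤ Real.log 2 := by linarith
  have : (kOf n : ℝ) * Real.log 2 ≤ 83200000 * n / 6931472 * Real.log 2 :=
    mul_le_mul_of_nonneg_right hk h2nn
  nlinarith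

/-- **`ψ(x) ≤ 1.04 x` for `0 ≤ x ≤ 10⁴`.** [cite: RosserSchoenfeld1962, Theorem 12] -/
theorem psi_le_of_le_ten_thousand {x : ℝ} (hx0 : 0 ≤ x) (hx : x ≤ 10000) : ψ x ≤ 1.04 * x := by
  rw [Chebyshev.psi_eq_psi_coe_floor]
  rcases Nat.eq_zero_or_pos ⌊x⌋₊ with h0 | hpos
  · rw [h0, Nat.cast_zero, Chebyshev.psi_zero]; positivity
  · have hfl : (⌊x⌋₊ : ℝ) ≤ x := Nat.floor_le hx0
    have hn : ⌊x⌋₊ ≤ 10000 := Nat.floor_le_of_le (by simpa using hx)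
    have := psi_nat_lt hpos hn
    linarith

end SchoenfeldBound

end Literature.NumberTheory.LFunctions
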